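import Summits.QuantumFields.BalabanUV.Beta.GAN24.ForcingFacePairFormGlue
import Summits.QuantumFields.BalabanUV.Beta.GAN24.FourFaceSourceWordsDeep
import Summits.QuantumFields.BalabanUV.Beta.GAN24.FaceWWordVanishing
import Summits.QuantumFields.BalabanUV.Beta.GAN24.WSlotT2OfPieces

/-!
# GAN24 ∕ PART VI ∕ T6-STEP SUPPLIER — Part 50c: road-P2's forcing pair form `hBF` for the dressed step, GIVEN the F5 antisymmetries

[folklore] bookkeeping of the crux team's leaf 02.  **THE ADAPTER** between Part 47 (`FourFaceSourceWordsDeep.faceRead_dressedSource_inl_inl`: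
the `P`-face read of the dressed source `c•mmRead Lc (K3OfK X̃ Lc S M W̃ …) + cB•B` is `c·(−K²)·Σ_{r′,u′}[faces]·(direct + swapped − W)`)
and Part 49 (`ForcingFacePairFormGlue.pairFormLS_of_threeWords`: three words + `LS(W word) = 0` + F5 ⟹ `∃ T antisym²`), for
`X̃ = unitK sf sm (coDressKBmAt (toSite r) Lc (KInvStep Lc j))`, `W̃ = W2SymOfK X̃ Lc S M 0 M₂`, coarse period `P ≥ 1`, deep period
`Lc·P`: the per-bond display of Part 47 is split into the three face words (free-bond summabilities: Part 45 `summable_word_coarse(_right)`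
with Part 46's uniform bi-localisation of `dM X̃`, and Part 50a `summable_faceWord_W2SymOfK_zero₂` for the W word), the W word's
leg-symmetrisation vanishes by Part 50b `faceWWord_LS_eq_zero`, the coarse-to-deep push is Part 46 `tsum_faceBond_dM_dressedStep` ∕
`dM_dressedStep_translate_coarse`, and Part 49 concludes.  RESULT `forcingPairForm_dressedStep`: literally the `(m, i)`-instance shape of
road-P2's hypothesis `hBF` (g50 `CombChargeTowerClosure`), for ANY first tables `S`, `M` (local ∕ vertex family, `Lc`-block covariant,
parity-odd rows), ANY mixed table `M₂` (`LocStencilFM`, block translation law), ANY `B` with vanishing `inl–inl` block, GIVEN the two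
F5 antisymmetries `hL` ∕ `hR` of the first field table at the deep period `Lc·P` (leaf-04 `CurrentSymTower`, hypotheses here).

HONEST: NOT IN PRINT; `hL` ∕ `hR` are hypotheses; nothing of `(C)_{≥1}` ∕ `hB0` ∕ `hBF` ∕ `hX` is discharged for road-P2's actual tower
letters until F5 lands and road-P2 instantiates; NEVER "G-an2-4 closed"; NOT D1, NOT `BetaPertH`, NOT continuum, NOT Clay.
-/

noncomputable section

open Finset
open scoped BigOperators
open Literature.MathematicalPhysics.QuantumFieldTheory
open Literature.MathematicalPhysics.QuantumFieldTheory.Balaban1983to89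
open Literature.MathematicalPhysics.QuantumFieldTheory.Balaban1983to89.Beta
open B12Sec2to5 (l1)
open ExpKernelCalculus (Site MKer Decays BiLoc VertexFamily VertexFamily₂ shiftK comp)
open OneStepResolventKernel (Fib LocStencil biLoc_mono)
open BalabanCompositeJets (LocStencil₂)
open AffineAveraging (box toSite)
open OneStepKernelFamily (KInvStep decays_KInvStep shiftK_KInvStep)
open SecondOrderResponse (dM K2OfK W2SymOfK LocStencilFM vertexFamily₂_W2SymOfK')
open BalabanStepW2 (K3OfK)
open BalabanStepJetsSucc (mmRead)
open BalabanStepJets (locStencil_mono)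
open Summit.QuantumFields.BalabanUV.Beta.TameKernelCalculus (Loc trK)
open Summit.QuantumFields.BalabanUV.Beta.BorderedHessian (stepScale sgnK)
open Summit.QuantumFields.BalabanUV.Beta.AxialDressingRooted (coDressKBmAt shiftK_coDressKBmAt decays_coDressKBmAt)
open Summit.QuantumFields.BalabanUV.Beta.HessKerDressedUnits (unitK decays_unitK)
open Summit.QuantumFields.BalabanUV.Beta.GAN24.BiStencilZeroMode (Tab)
open Summit.QuantumFields.BalabanUV.Beta.GAN24.WSlotT2OfPieces (locStencil₂_zero)
open Summit.QuantumFields.BalabanUV.Beta.GAN24.FaceWordsDeepCurrents (summable_word_coarse summable_word_coarse_right)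
open Summit.QuantumFields.BalabanUV.Beta.GAN24.DressedVertexFacePush (tsum_faceBond_dM_dressedStep exists_vertexFamily_dM_dressedStep
  dM_dressedStep_translate_coarse)
open Summit.QuantumFields.BalabanUV.Beta.GAN24.FourFaceSourceWordsDeep (faceRead_dressedSource_inl_inl)
open Summit.QuantumFields.BalabanUV.Beta.GAN24.ForcingFacePairFormGlue (pairFormLS_of_threeWords)
open Summit.QuantumFields.BalabanUV.Beta.GAN24.FaceWWordLetters (locStencilFM_mono)
open Summit.QuantumFields.BalabanUV.Beta.GAN24.FaceWWordSummable (summable_faceWord_W2SymOfK_zero₂)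
open Summit.QuantumFields.BalabanUV.Beta.GAN24.FaceWWordVanishing (faceWWord_LS_eq_zero)

namespace Summit.QuantumFields.BalabanUV.Beta.GAN24.ForcingFacePairFormAssembly

variable {d : ℕ}

/-- [folklore] `if A ∧ B then (a + b − w) else 0 = [A][B]·a + [A][B]·b − [A][B]·w`. -/
theorem ite_and_three (A B : Prop) [Decidable A] [Decidable B] (a b w : ℝ) :
    (if A ∧ B then a + b - w else 0)
      = (if A then (1 : ℝ) else 0) * (if B then (1 : ℝ) else 0) * a + (if A then (1 : ℝ) else 0) * (if B then (1 : ℝ) else 0) * b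
        - (if A then (1 : ℝ) else 0) * (if B then (1 : ℝ) else 0) * w := by
  by_cases hA : A <;> by_cases hB : B <;> simp [hA, hB]

variable {Lc : ℕ} [NeZero Lc] {r : Fin (d + 1) → ℕ}

set_option maxHeartbeats 400000 in
/-- NOT IN PRINT; OUR BOOKKEEPING.  **ROAD-P2's FORCING PAIR FORM FOR THE DRESSED STEP, GIVEN F5.**  For the dressed step kernel
`X̃ = unitK sf sm (coDressKBmAt (toSite r) Lc (KInvStep Lc j))`, first tables `S` (local, `Lc`-block covariant, parity-odd rows) and `M`
(vertex family at scale `Lc`, block translation law, parity-odd rows), mixed table `M₂` (`LocStencilFM`, block translation law), any `B` with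
vanishing `inl–inl` block, constants `c`, `cB`, coarse period `P ≥ 1`, and GIVEN the two deep-face antisymmetries `hL` ∕ `hR` of `S` at the
deep period `Lc·P` (leaf-04 F5): the leg-symmetrised `P`-face read of the dressed source
`FF(μ,ν;α,β) := Σ_{r′ ∈ box P} Σ'_{u′} Σ'_x Σ'_z [r′_μ][u′_ν][x_α][z_β]_P · (c•mmRead Lc (K3OfK X̃ Lc S M W̃ μ r′ ν u′) + cB•B μ r′ ν u′) x z (inl α)(inl β)`,
`W̃ = W2SymOfK X̃ Lc S M 0 M₂`, is an `∃ T antisym²` pair form in road-P2's `hBF` spelling.  (v1.1: `maxHeartbeats 400000` for this one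
declaration — its STATEMENT is road-P2's literal and elaborates with < 15 % margin at the default; leaf-06 g58's 170k audit, journal l.60589.) -/
theorem forcingPairForm_dressedStep (hLc : 1 ≤ Lc) (hr : r ∈ box (d + 1) Lc) {P : ℕ} (hP : 1 ≤ P) (sf sm : ℝ) (j : ℕ)
    {S M : Fin (d + 1) → Site (d + 1) → MKer (d + 1) (Fib d)} {Cs δs CM δM : ℝ}
    (hS : LocStencil S Cs δs) (hδs : 0 < δs) (hM : VertexFamily M Lc CM δM) (hδM : 0 < δM)
    (hSt : ∀ (κ : Fin (d + 1)) (u t : Site (d + 1)), S κ (u + (Lc : ℤ) • t) = shiftK (-((Lc : ℤ) • t)) (S κ u))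
    (hMt : ∀ (ρ : Fin (d + 1)) (w t : Site (d + 1)), M ρ (w + t) = shiftK (-((Lc : ℤ) • t)) (M ρ w))
    (hSrow : ∀ κ u, trK (S κ u) = -sgnK (S κ u)) (hMrow : ∀ ρ w, trK (M ρ w) = -sgnK (M ρ w))
    {M₂ : Fin (d + 1) → Site (d + 1) → Fin (d + 1) → Site (d + 1) → MKer (d + 1) (Fib d)} {C₂ δ₂ : ℝ} (hM₂ : LocStencilFM Lc M₂ C₂ δ₂) (hδ₂ : 0 < δ₂)
    (hM₂t : ∀ (κ : Fin (d + 1)) (u : Site (d + 1)) (ρ : Fin (d + 1)) (w t : Site (d + 1)), M₂ κ (u + (Lc : ℤ) • t) ρ (w + t) = shiftK (-((Lc : ℤ) • t)) (M₂ κ u ρ w))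
    {B : Tab d} (hBff : ∀ κ u κ' u' x z (α β : Fin (d + 1)), B κ u κ' u' x z (Sum.inl α) (Sum.inl β) = 0) (c cB : ℝ)
    (hL : ∀ (ν β : Fin (d + 1)) (p : Site (d + 1)) (a' : Fib d),
      (∑' q : Site (d + 1), (if q β % ((Lc * P : ℕ) : ℤ) = ((Lc * P : ℕ) : ℤ) - 1 then (1 : ℝ) else 0) *
          ∑' u : Site (d + 1), (if u ν % ((Lc * P : ℕ) : ℤ) = ((Lc * P : ℕ) : ℤ) - 1 then (1 : ℝ) else 0) * S ν u q p (Sum.inl β) a') +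
        (∑' q : Site (d + 1), (if q ν % ((Lc * P : ℕ) : ℤ) = ((Lc * P : ℕ) : ℤ) - 1 then (1 : ℝ) else 0) *
          ∑' u : Site (d + 1), (if u β % ((Lc * P : ℕ) : ℤ) = ((Lc * P : ℕ) : ℤ) - 1 then (1 : ℝ) else 0) * S β u q p (Sum.inl ν) a') = 0)
    (hR : ∀ (μ ν : Fin (d + 1)) (s : Site (d + 1)) (f : Fib d),
      (∑' s' : Site (d + 1), (if s' ν % ((Lc * P : ℕ) : ℤ) = ((Lc * P : ℕ) : ℤ) - 1 then (1 : ℝ) else 0) *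
          ∑' t' : Site (d + 1), (if t' μ % ((Lc * P : ℕ) : ℤ) = ((Lc * P : ℕ) : ℤ) - 1 then (1 : ℝ) else 0) * S μ t' s s' f (Sum.inl ν)) +
        (∑' s' : Site (d + 1), (if s' μ % ((Lc * P : ℕ) : ℤ) = ((Lc * P : ℕ) : ℤ) - 1 then (1 : ℝ) else 0) *
          ∑' t' : Site (d + 1), (if t' ν % ((Lc * P : ℕ) : ℤ) = ((Lc * P : ℕ) : ℤ) - 1 then (1 : ℝ) else 0) * S ν t' s s' f (Sum.inl μ)) = 0) :
    ∃ T : Fin (d + 1) → Fin (d + 1) → Fin (d + 1) → Fin (d + 1) → ℝ,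
      (∀ a b c e, T b a c e = -T a b c e) ∧ (∀ a b c e, T a b e c = -T a b c e) ∧
      ∀ κ κ' κ₁ κ₂ : Fin (d + 1),
        ((fun μ ν α β : Fin (d + 1) => ∑ r' ∈ box (d + 1) P, ∑' u' : Site (d + 1), ∑' x : Site (d + 1), ∑' z : Site (d + 1),
            (if toSite r' μ % (P : ℤ) = (P : ℤ) - 1 ∧ u' ν % (P : ℤ) = (P : ℤ) - 1 ∧ x α % (P : ℤ) = (P : ℤ) - 1 ∧ z β % (P : ℤ) = (P : ℤ) - 1 then
              (c • mmRead Lc (K3OfK (unitK sf sm (coDressKBmAt (toSite r) Lc (KInvStep (d := d) Lc j))) Lc S M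
                  (W2SymOfK (unitK sf sm (coDressKBmAt (toSite r) Lc (KInvStep (d := d) Lc j))) Lc S M 0 M₂) μ (toSite r') ν u')
                + cB • B μ (toSite r') ν u') x z (Sum.inl α) (Sum.inl β) else 0)) κ κ' κ₁ κ₂
          + (fun μ ν α β : Fin (d + 1) => ∑ r' ∈ box (d + 1) P, ∑' u' : Site (d + 1), ∑' x : Site (d + 1), ∑' z : Site (d + 1),
            (if toSite r' μ % (P : ℤ) = (P : ℤ) - 1 ∧ u' ν % (P : ℤ) = (P : ℤ) - 1 ∧ x α % (P : ℤ) = (P : ℤ) - 1 ∧ z β % (P : ℤ) = (P : ℤ) - 1 then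
              (c • mmRead Lc (K3OfK (unitK sf sm (coDressKBmAt (toSite r) Lc (KInvStep (d := d) Lc j))) Lc S M
                  (W2SymOfK (unitK sf sm (coDressKBmAt (toSite r) Lc (KInvStep (d := d) Lc j))) Lc S M 0 M₂) μ (toSite r') ν u')
                + cB • B μ (toSite r') ν u') x z (Sum.inl α) (Sum.inl β) else 0)) κ' κ κ₁ κ₂)
        + ((fun μ ν α β : Fin (d + 1) => ∑ r' ∈ box (d + 1) P, ∑' u' : Site (d + 1), ∑' x : Site (d + 1), ∑' z : Site (d + 1),
            (if toSite r' μ % (P : ℤ) = (P : ℤ) - 1 ∧ u' ν % (P : ℤ) = (P : ℤ) - 1 ∧ x α % (P : ℤ) = (P : ℤ) - 1 ∧ z β % (P : ℤ) = (P : ℤ) - 1 then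
              (c • mmRead Lc (K3OfK (unitK sf sm (coDressKBmAt (toSite r) Lc (KInvStep (d := d) Lc j))) Lc S M
                  (W2SymOfK (unitK sf sm (coDressKBmAt (toSite r) Lc (KInvStep (d := d) Lc j))) Lc S M 0 M₂) μ (toSite r') ν u')
                + cB • B μ (toSite r') ν u') x z (Sum.inl α) (Sum.inl β) else 0)) κ' κ κ₁ κ₂
          + (fun μ ν α β : Fin (d + 1) => ∑ r' ∈ box (d + 1) P, ∑' u' : Site (d + 1), ∑' x : Site (d + 1), ∑' z : Site (d + 1),
            (if toSite r' μ % (P : ℤ) = (P : ℤ) - 1 ∧ u' ν % (P : ℤ) = (P : ℤ) - 1 ∧ x α % (P : ℤ) = (P : ℤ) - 1 ∧ z β % (P : ℤ) = (P : ℤ) - 1 then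
              (c • mmRead Lc (K3OfK (unitK sf sm (coDressKBmAt (toSite r) Lc (KInvStep (d := d) Lc j))) Lc S M
                  (W2SymOfK (unitK sf sm (coDressKBmAt (toSite r) Lc (KInvStep (d := d) Lc j))) Lc S M 0 M₂) μ (toSite r') ν u')
                + cB • B μ (toSite r') ν u') x z (Sum.inl α) (Sum.inl β) else 0)) κ κ' κ₁ κ₂)
        + (((fun μ ν α β : Fin (d + 1) => ∑ r' ∈ box (d + 1) P, ∑' u' : Site (d + 1), ∑' x : Site (d + 1), ∑' z : Site (d + 1),
            (if toSite r' μ % (P : ℤ) = (P : ℤ) - 1 ∧ u' ν % (P : ℤ) = (P : ℤ) - 1 ∧ x α % (P : ℤ) = (P : ℤ) - 1 ∧ z β % (P : ℤ) = (P : ℤ) - 1 then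
              (c • mmRead Lc (K3OfK (unitK sf sm (coDressKBmAt (toSite r) Lc (KInvStep (d := d) Lc j))) Lc S M
                  (W2SymOfK (unitK sf sm (coDressKBmAt (toSite r) Lc (KInvStep (d := d) Lc j))) Lc S M 0 M₂) μ (toSite r') ν u')
                + cB • B μ (toSite r') ν u') x z (Sum.inl α) (Sum.inl β) else 0)) κ κ' κ₂ κ₁
          + (fun μ ν α β : Fin (d + 1) => ∑ r' ∈ box (d + 1) P, ∑' u' : Site (d + 1), ∑' x : Site (d + 1), ∑' z : Site (d + 1),
            (if toSite r' μ % (P : ℤ) = (P : ℤ) - 1 ∧ u' ν % (P : ℤ) = (P : ℤ) - 1 ∧ x α % (P : ℤ) = (P : ℤ) - 1 ∧ z β % (P : ℤ) = (P : ℤ) - 1 then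
              (c • mmRead Lc (K3OfK (unitK sf sm (coDressKBmAt (toSite r) Lc (KInvStep (d := d) Lc j))) Lc S M
                  (W2SymOfK (unitK sf sm (coDressKBmAt (toSite r) Lc (KInvStep (d := d) Lc j))) Lc S M 0 M₂) μ (toSite r') ν u')
                + cB • B μ (toSite r') ν u') x z (Sum.inl α) (Sum.inl β) else 0)) κ' κ κ₂ κ₁)
        + ((fun μ ν α β : Fin (d + 1) => ∑ r' ∈ box (d + 1) P, ∑' u' : Site (d + 1), ∑' x : Site (d + 1), ∑' z : Site (d + 1),
            (if toSite r' μ % (P : ℤ) = (P : ℤ) - 1 ∧ u' ν % (P : ℤ) = (P : ℤ) - 1 ∧ x α % (P : ℤ) = (P : ℤ) - 1 ∧ z β % (P : ℤ) = (P : ℤ) - 1 then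
              (c • mmRead Lc (K3OfK (unitK sf sm (coDressKBmAt (toSite r) Lc (KInvStep (d := d) Lc j))) Lc S M
                  (W2SymOfK (unitK sf sm (coDressKBmAt (toSite r) Lc (KInvStep (d := d) Lc j))) Lc S M 0 M₂) μ (toSite r') ν u')
                + cB • B μ (toSite r') ν u') x z (Sum.inl α) (Sum.inl β) else 0)) κ' κ κ₂ κ₁
          + (fun μ ν α β : Fin (d + 1) => ∑ r' ∈ box (d + 1) P, ∑' u' : Site (d + 1), ∑' x : Site (d + 1), ∑' z : Site (d + 1),
            (if toSite r' μ % (P : ℤ) = (P : ℤ) - 1 ∧ u' ν % (P : ℤ) = (P : ℤ) - 1 ∧ x α % (P : ℤ) = (P : ℤ) - 1 ∧ z β % (P : ℤ) = (P : ℤ) - 1 then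
              (c • mmRead Lc (K3OfK (unitK sf sm (coDressKBmAt (toSite r) Lc (KInvStep (d := d) Lc j))) Lc S M
                  (W2SymOfK (unitK sf sm (coDressKBmAt (toSite r) Lc (KInvStep (d := d) Lc j))) Lc S M 0 M₂) μ (toSite r') ν u')
                + cB • B μ (toSite r') ν u') x z (Sum.inl α) (Sum.inl β) else 0)) κ κ' κ₂ κ₁))
          = T κ κ₁ κ' κ₂ + T κ' κ₁ κ κ₂ + (T κ κ₂ κ' κ₁ + T κ' κ₂ κ κ₁) := by
  classical
  haveI : NeZero P := ⟨by omega⟩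
  haveI : NeZero (Lc * P) := ⟨(Nat.mul_pos (by omega) (by omega)).ne'⟩
  -- the dressed kernel: decay and `Lc`-block periodicity
  obtain ⟨δK, C', hδK, hC', hK'⟩ := decays_coDressKBmAt hLc hr (decays_KInvStep (d := d) (Lc := Lc) j)
  have hKu := decays_unitK (sf := sf) (sm := sm) hK'
  have hCK0 : 0 ≤ max |sf| |sm| * C' * max |sf| |sm| := hKu.nonneg (Sum.inl 0)
  have hXs : ∀ t : Site (d + 1), shiftK (-((Lc : ℤ) • t)) (unitK sf sm (coDressKBmAt (toSite r) Lc (KInvStep (d := d) Lc j)))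
      = unitK sf sm (coDressKBmAt (toSite r) Lc (KInvStep (d := d) Lc j)) := by
    intro t
    show unitK sf sm (shiftK (-((Lc : ℤ) • t)) (coDressKBmAt (toSite r) Lc (KInvStep (d := d) Lc j))) = _
    rw [shiftK_coDressKBmAt (toSite r) hLc (shiftK_KInvStep (d := d) (Lc := Lc) j) t]
  have esmul : ∀ s : Site (d + 1), ((Lc * P : ℕ) : ℤ) • s = (Lc : ℤ) • ((P : ℤ) • s) := by
    intro s; rw [smul_smul, Nat.cast_mul]
  have hXt : ∀ s : Site (d + 1), shiftK (-(((Lc * P : ℕ) : ℤ) • s)) (unitK sf sm (coDressKBmAt (toSite r) Lc (KInvStep (d := d) Lc j)))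
      = unitK sf sm (coDressKBmAt (toSite r) Lc (KInvStep (d := d) Lc j)) := by
    intro s; rw [esmul]; exact hXs ((P : ℤ) • s)
  have hStN : ∀ (κ : Fin (d + 1)) (t s : Site (d + 1)), S κ (t + ((Lc * P : ℕ) : ℤ) • s) = shiftK (-(((Lc * P : ℕ) : ℤ) • s)) (S κ t) := by
    intro κ t s; rw [esmul]; exact hSt κ t ((P : ℤ) • s)
  -- the dressed vertex family and a common rate
  obtain ⟨CD, δD, hδD, hV⟩ := exists_vertexFamily_dM_dressedStep hLc hr sf sm j hS hδs hM hδM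
  have hCs : 0 ≤ Cs := (hS 0 0).nonneg (Sum.inl 0)
  have hCM : 0 ≤ CM := (hM 0 0).nonneg (Sum.inl 0)
  have hCD : 0 ≤ CD := (hV 0 0).nonneg (Sum.inl 0)
  have hC₂ : 0 ≤ C₂ := hM₂.nonneg
  set m₀ : ℝ := min (min (min (min δK δs) δM) δ₂) δD with hm₀
  have hm0 : 0 < m₀ := lt_min (lt_min (lt_min (lt_min hδK hδs) hδM) hδ₂) hδD
  have hKm : Decays (unitK sf sm (coDressKBmAt (toSite r) Lc (KInvStep (d := d) Lc j))) (max |sf| |sm| * C' * max |sf| |sm|) m₀ :=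
    OneStepResolventKernel.decays_mono hKu hCK0 le_rfl
      ((min_le_left _ _).trans ((min_le_left _ _).trans ((min_le_left _ _).trans (min_le_left _ _))))
  have hSm : LocStencil S Cs m₀ :=
    locStencil_mono hS hCs ((min_le_left _ _).trans ((min_le_left _ _).trans ((min_le_left _ _).trans (min_le_right _ _))))
  have hMm : VertexFamily M Lc CM m₀ := BalabanStepW2.vertexFamily_mono' hM hCM ((min_le_left _ _).trans ((min_le_left _ _).trans (min_le_right _ _)))
  have hM₂m : LocStencilFM Lc M₂ C₂ m₀ := locStencilFM_mono hM₂ hC₂ ((min_le_left _ _).trans (min_le_right _ _))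
  have hDm : ∀ (κ : Fin (d + 1)) (u : Site (d + 1)),
      BiLoc (dM (unitK sf sm (coDressKBmAt (toSite r) Lc (KInvStep (d := d) Lc j))) Lc S M κ u) ((Lc : ℤ) • u) ((Lc : ℤ) • u) CD m₀ :=
    fun κ u => biLoc_mono (hV κ u) hCD (min_le_right _ _)
  -- `Loc` of the two dressed letters (Part 47's hypotheses)
  have hb : ∀ (κ : Fin (d + 1)) (y : Site (d + 1)), Loc (dM (unitK sf sm (coDressKBmAt (toSite r) Lc (KInvStep (d := d) Lc j))) Lc S M κ y) :=
    fun κ y => ⟨_, _, _, _, hδD, hV κ y⟩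
  obtain ⟨Cw, δw, hδw, hVW⟩ := vertexFamily₂_W2SymOfK' (N := Lc) ⟨δK, _, hδK, hCK0, hKu⟩ hS hδs hM hδM (locStencil₂_zero (d := d) 1) one_pos hM₂ hδ₂
  have hW : ∀ (κ : Fin (d + 1)) (y : Site (d + 1)) (κ' : Fin (d + 1)) (y' : Site (d + 1)),
      Loc (W2SymOfK (unitK sf sm (coDressKBmAt (toSite r) Lc (KInvStep (d := d) Lc j))) Lc S M 0 M₂ κ y κ' y') :=
    fun κ y κ' y' => ⟨_, _, _, _, hδw, hVW κ y κ' y'⟩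
  -- masks
  have hχ : ∀ s : ℤ, |(fun s : ℤ => if s % (P : ℤ) = (P : ℤ) - 1 then (1 : ℝ) else 0) s| ≤ 1 := by
    intro s; simp only; split_ifs <;> simp
  have hχχ : ∀ (A : Prop) [Decidable A] (ν : Fin (d + 1)) (u' : Site (d + 1)),
      |(fun u' : Site (d + 1) => (if A then (1 : ℝ) else 0) * (if u' ν % (P : ℤ) = (P : ℤ) - 1 then (1 : ℝ) else 0)) u'| ≤ 1 := by
    intro A _ ν u'; simp only; split_ifs <;> simp
  have hmm : ∀ (α β : Fin (d + 1)) (yw : Site (d + 1) × Site (d + 1)),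
      |(fun yw : Site (d + 1) × Site (d + 1) => (if yw.1 α % ((Lc * P : ℕ) : ℤ) = ((Lc * P : ℕ) : ℤ) - 1 then (1 : ℝ) else 0) *
        (if yw.2 β % ((Lc * P : ℕ) : ℤ) = ((Lc * P : ℕ) : ℤ) - 1 then (1 : ℝ) else 0)) yw| ≤ 1 := by
    intro α β yw; simp only; split_ifs <;> simp
  have hLP : (Lc : ℤ) * (P : ℤ) = ((Lc * P : ℕ) : ℤ) := by push_cast; ring
  -- the three-word display (Part 47, split by the free-bond summabilities)
  have hdisp : ∀ μ ν α β : Fin (d + 1),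
      (∑ r' ∈ box (d + 1) P, ∑' u' : Site (d + 1), ∑' x : Site (d + 1), ∑' z : Site (d + 1),
          (if toSite r' μ % (P : ℤ) = (P : ℤ) - 1 ∧ u' ν % (P : ℤ) = (P : ℤ) - 1 ∧ x α % (P : ℤ) = (P : ℤ) - 1 ∧ z β % (P : ℤ) = (P : ℤ) - 1 then
            (c • mmRead Lc (K3OfK (unitK sf sm (coDressKBmAt (toSite r) Lc (KInvStep (d := d) Lc j))) Lc S M
                (W2SymOfK (unitK sf sm (coDressKBmAt (toSite r) Lc (KInvStep (d := d) Lc j))) Lc S M 0 M₂) μ (toSite r') ν u')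
              + cB • B μ (toSite r') ν u') x z (Sum.inl α) (Sum.inl β) else 0))
        = c * -(((sf * sm) * (stepScale d Lc j * (Lc : ℝ) ^ (d + 1))⁻¹) * ((sf * sm) * (stepScale d Lc j * (Lc : ℝ) ^ (d + 1))⁻¹)) *
          ((∑ r' ∈ box (d + 1) P, ∑' u' : Site (d + 1), (if toSite r' μ % (P : ℤ) = (P : ℤ) - 1 then (1 : ℝ) else 0) * (if u' ν % (P : ℤ) = (P : ℤ) - 1 then (1 : ℝ) else 0) *
              ∑' yw : Site (d + 1) × Site (d + 1), ((if yw.1 α % ((Lc * P : ℕ) : ℤ) = ((Lc * P : ℕ) : ℤ) - 1 then (1 : ℝ) else 0) *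
                  (if yw.2 β % ((Lc * P : ℕ) : ℤ) = ((Lc * P : ℕ) : ℤ) - 1 then (1 : ℝ) else 0)) *
                comp (comp (dM (unitK sf sm (coDressKBmAt (toSite r) Lc (KInvStep (d := d) Lc j))) Lc S M μ (toSite r'))
                  (unitK sf sm (coDressKBmAt (toSite r) Lc (KInvStep (d := d) Lc j))))
                  (dM (unitK sf sm (coDressKBmAt (toSite r) Lc (KInvStep (d := d) Lc j))) Lc S M ν u') yw.1 yw.2 (Sum.inl α) (Sum.inl β)) +
           (∑ r' ∈ box (d + 1) P, ∑' u' : Site (d + 1), (if toSite r' μ % (P : ℤ) = (P : ℤ) - 1 then (1 : ℝ) else 0) * (if u' ν % (P : ℤ) = (P : ℤ) - 1 then (1 : ℝ) else 0) *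
              ∑' yw : Site (d + 1) × Site (d + 1), ((if yw.1 α % ((Lc * P : ℕ) : ℤ) = ((Lc * P : ℕ) : ℤ) - 1 then (1 : ℝ) else 0) *
                  (if yw.2 β % ((Lc * P : ℕ) : ℤ) = ((Lc * P : ℕ) : ℤ) - 1 then (1 : ℝ) else 0)) *
                comp (comp (dM (unitK sf sm (coDressKBmAt (toSite r) Lc (KInvStep (d := d) Lc j))) Lc S M ν u')
                  (unitK sf sm (coDressKBmAt (toSite r) Lc (KInvStep (d := d) Lc j))))
                  (dM (unitK sf sm (coDressKBmAt (toSite r) Lc (KInvStep (d := d) Lc j))) Lc S M μ (toSite r')) yw.1 yw.2 (Sum.inl α) (Sum.inl β)) -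
           (∑ r' ∈ box (d + 1) P, ∑' u' : Site (d + 1), (if toSite r' μ % (P : ℤ) = (P : ℤ) - 1 then (1 : ℝ) else 0) * (if u' ν % (P : ℤ) = (P : ℤ) - 1 then (1 : ℝ) else 0) *
              ∑' yw : Site (d + 1) × Site (d + 1), (if yw.1 α % ((Lc * P : ℕ) : ℤ) = ((Lc * P : ℕ) : ℤ) - 1 then (1 : ℝ) else 0) *
                  (if yw.2 β % ((Lc * P : ℕ) : ℤ) = ((Lc * P : ℕ) : ℤ) - 1 then (1 : ℝ) else 0) *
                W2SymOfK (unitK sf sm (coDressKBmAt (toSite r) Lc (KInvStep (d := d) Lc j))) Lc S M 0 M₂ μ (toSite r') ν u' yw.1 yw.2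
                  (Sum.inl α) (Sum.inl β))) := by
    intro μ ν α β
    have h47 := faceRead_dressedSource_inl_inl (d := d) hLc hr hP sf sm j
      (W := W2SymOfK (unitK sf sm (coDressKBmAt (toSite r) Lc (KInvStep (d := d) Lc j))) Lc S M 0 M₂) (B := B) c cB hb hW hBff μ ν α β
    simp only [hLP] at h47
    rw [h47]
    congr 1
    -- free-bond summabilities of the three words
    have Sa : ∀ r' : Fin (d + 1) → ℕ, Summable fun u' : Site (d + 1) =>
        (if toSite r' μ % (P : ℤ) = (P : ℤ) - 1 then (1 : ℝ) else 0) * (if u' ν % (P : ℤ) = (P : ℤ) - 1 then (1 : ℝ) else 0) *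
          ∑' yw : Site (d + 1) × Site (d + 1), ((if yw.1 α % ((Lc * P : ℕ) : ℤ) = ((Lc * P : ℕ) : ℤ) - 1 then (1 : ℝ) else 0) *
              (if yw.2 β % ((Lc * P : ℕ) : ℤ) = ((Lc * P : ℕ) : ℤ) - 1 then (1 : ℝ) else 0)) *
            comp (comp (dM (unitK sf sm (coDressKBmAt (toSite r) Lc (KInvStep (d := d) Lc j))) Lc S M μ (toSite r'))
              (unitK sf sm (coDressKBmAt (toSite r) Lc (KInvStep (d := d) Lc j))))
              (dM (unitK sf sm (coDressKBmAt (toSite r) Lc (KInvStep (d := d) Lc j))) Lc S M ν u') yw.1 yw.2 (Sum.inl α) (Sum.inl β) :=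
      fun r' => summable_word_coarse_right (D := dM (unitK sf sm (coDressKBmAt (toSite r) Lc (KInvStep (d := d) Lc j))) Lc S M) hLc
        (hDm μ (toSite r')) hKm hm0 hDm ν _ (hχχ _ ν) _ (hmm α β) (Sum.inl α) (Sum.inl β)
    have Sb : ∀ r' : Fin (d + 1) → ℕ, Summable fun u' : Site (d + 1) =>
        (if toSite r' μ % (P : ℤ) = (P : ℤ) - 1 then (1 : ℝ) else 0) * (if u' ν % (P : ℤ) = (P : ℤ) - 1 then (1 : ℝ) else 0) *
          ∑' yw : Site (d + 1) × Site (d + 1), ((if yw.1 α % ((Lc * P : ℕ) : ℤ) = ((Lc * P : ℕ) : ℤ) - 1 then (1 : ℝ) else 0) *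
              (if yw.2 β % ((Lc * P : ℕ) : ℤ) = ((Lc * P : ℕ) : ℤ) - 1 then (1 : ℝ) else 0)) *
            comp (comp (dM (unitK sf sm (coDressKBmAt (toSite r) Lc (KInvStep (d := d) Lc j))) Lc S M ν u')
              (unitK sf sm (coDressKBmAt (toSite r) Lc (KInvStep (d := d) Lc j))))
              (dM (unitK sf sm (coDressKBmAt (toSite r) Lc (KInvStep (d := d) Lc j))) Lc S M μ (toSite r')) yw.1 yw.2 (Sum.inl α) (Sum.inl β) :=
      fun r' => summable_word_coarse (D := dM (unitK sf sm (coDressKBmAt (toSite r) Lc (KInvStep (d := d) Lc j))) Lc S M) hLc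
        (hDm μ (toSite r')) hKm hm0 hDm ν _ (hχχ _ ν) _ (hmm α β) (Sum.inl α) (Sum.inl β)
    have Sw : ∀ r' : Fin (d + 1) → ℕ, Summable fun u' : Site (d + 1) =>
        (if toSite r' μ % (P : ℤ) = (P : ℤ) - 1 then (1 : ℝ) else 0) * (if u' ν % (P : ℤ) = (P : ℤ) - 1 then (1 : ℝ) else 0) *
          ∑' yw : Site (d + 1) × Site (d + 1), (if yw.1 α % ((Lc * P : ℕ) : ℤ) = ((Lc * P : ℕ) : ℤ) - 1 then (1 : ℝ) else 0) *
              (if yw.2 β % ((Lc * P : ℕ) : ℤ) = ((Lc * P : ℕ) : ℤ) - 1 then (1 : ℝ) else 0) *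
            W2SymOfK (unitK sf sm (coDressKBmAt (toSite r) Lc (KInvStep (d := d) Lc j))) Lc S M 0 M₂ μ (toSite r') ν u' yw.1 yw.2
              (Sum.inl α) (Sum.inl β) :=
      fun r' => summable_faceWord_W2SymOfK_zero₂ (N := Lc) hLc hKm hCK0 hm0 hSm hMm hM₂m μ (toSite r') ν _ (hχχ _ ν) _ α β (Sum.inl α) (Sum.inl β)
    rw [← Finset.sum_add_distrib, ← Finset.sum_sub_distrib]
    refine Finset.sum_congr rfl fun r' _ => ?_
    rw [← (Sa r').tsum_add (Sb r'), ← ((Sa r').add (Sb r')).tsum_sub (Sw r')]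
    refine tsum_congr fun u' => ?_
    rw [ite_and_three]
  -- Part 49
  have h49 := pairFormLS_of_threeWords (d := d) (Lc := Lc) (P := P) (N := Lc * P)
    (X := unitK sf sm (coDressKBmAt (toSite r) Lc (KInvStep (d := d) Lc j)))
    (D := dM (unitK sf sm (coDressKBmAt (toSite r) Lc (KInvStep (d := d) Lc j))) Lc S M) (S := S)
    hLc hKm hXt hm0 hDm (fun κ u s => dM_dressedStep_translate_coarse (r := r) hLc sf sm j P hSt hMt κ u s) hSm hStN
    ((sf * sm) * (stepScale d Lc j * (Lc : ℝ) ^ (d + 1))⁻¹)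
    (fun κ x z a b => tsum_faceBond_dM_dressedStep hLc hr sf sm j κ hP hS hδs hM hδM x z a b) hL hR
    (c * -(((sf * sm) * (stepScale d Lc j * (Lc : ℝ) ^ (d + 1))⁻¹) * ((sf * sm) * (stepScale d Lc j * (Lc : ℝ) ^ (d + 1))⁻¹)))
    (F := fun μ ν α β : Fin (d + 1) => ∑ r' ∈ box (d + 1) P, ∑' u' : Site (d + 1), ∑' x : Site (d + 1), ∑' z : Site (d + 1),
      (if toSite r' μ % (P : ℤ) = (P : ℤ) - 1 ∧ u' ν % (P : ℤ) = (P : ℤ) - 1 ∧ x α % (P : ℤ) = (P : ℤ) - 1 ∧ z β % (P : ℤ) = (P : ℤ) - 1 then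
        (c • mmRead Lc (K3OfK (unitK sf sm (coDressKBmAt (toSite r) Lc (KInvStep (d := d) Lc j))) Lc S M
            (W2SymOfK (unitK sf sm (coDressKBmAt (toSite r) Lc (KInvStep (d := d) Lc j))) Lc S M 0 M₂) μ (toSite r') ν u')
          + cB • B μ (toSite r') ν u') x z (Sum.inl α) (Sum.inl β) else 0))
    (Ww := fun μ ν α β : Fin (d + 1) => ∑ r' ∈ box (d + 1) P, ∑' u' : Site (d + 1),
      (if toSite r' μ % (P : ℤ) = (P : ℤ) - 1 then (1 : ℝ) else 0) * (if u' ν % (P : ℤ) = (P : ℤ) - 1 then (1 : ℝ) else 0) *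
        ∑' yw : Site (d + 1) × Site (d + 1), (if yw.1 α % ((Lc * P : ℕ) : ℤ) = ((Lc * P : ℕ) : ℤ) - 1 then (1 : ℝ) else 0) *
            (if yw.2 β % ((Lc * P : ℕ) : ℤ) = ((Lc * P : ℕ) : ℤ) - 1 then (1 : ℝ) else 0) *
          W2SymOfK (unitK sf sm (coDressKBmAt (toSite r) Lc (KInvStep (d := d) Lc j))) Lc S M 0 M₂ μ (toSite r') ν u' yw.1 yw.2
            (Sum.inl α) (Sum.inl β))
    (fun μ ν α β => hdisp μ ν α β)
    (faceWWord_LS_eq_zero (d := d) hLc hr sf sm j (P := P) hS hδs hM hδM hSrow hMrow hM₂ hδ₂ hM₂t (((Lc * P : ℕ) : ℤ)) ⟨1, by push_cast; ring⟩)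
  exact h49

end Summit.QuantumFields.BalabanUV.Beta.GAN24.ForcingFacePairFormAssembly

end
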